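import Mathlib.LinearAlgebra.Projection
import Summits.Langlands.Langlands.Theorems.IrreducibilityBySelfDualityReciprocityUpToIrreducibilityRStringDefs
import HarnessLib

/-!
# Route IrreducibilityBySelfDuality — `ReciprocityUpToIrreducibilityR` (stmt-Langlands-17925), line `Sketch`:
# stub G3c `stub_finrank_homWDIn_sup` (`--supports` file; no definitions)

**Additivity of `dim Hom_WD(τ, σ; ·)` over an internal direct sum of sub-Weil–Deligne
representations.**  If `A, B ≤ V` are sub-Weil–Deligne representations of `σ = (ρ, N)` with
`A ⊓ B = 0`, then
`dim Hom_WD(τ, σ; A ⊕ B) = dim Hom_WD(τ, σ; A) + dim Hom_WD(τ, σ; B)`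
(the counting step of Henniart 2002, §4: `Hom` into a direct sum of strings is the direct sum of the
`Hom`s into the strings).

Proof (linear algebra).  Choose a linear projection `P : V → V` with `P = id` on `A` and `P = 0` on
`B` (a complement `C` of `A ⊔ B` exists over a field, `Submodule.exists_isCompl`; `A` and `B ⊔ C` are
complementary in the modular lattice of subspaces, `Disjoint.isCompl_sup_right_of_isCompl_sup_left`;
take `Submodule.projection`).  For `f ∈ Hom_WD(τ, σ; A ⊔ B)` both `P ∘ f` and `(id - P) ∘ f` are again
morphisms of Weil–Deligne representations, with values in `A`, `B` respectively: writing `f x = a + b`,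
stability of `A` and `B` under `ρ(w)` and `N` gives `P (ρ(w) (a + b)) = ρ(w) a = ρ(w) (P (a + b))`.
Hence `Hom_WD(τ, σ; A ⊔ B) = Hom_WD(τ, σ; A) ⊔ Hom_WD(τ, σ; B)` inside `Hom_ℂ(W, V)`, the two summands
meet in `0` (a map with values in `A ⊓ B = 0` vanishes), and the dimension formula
`dim (S ⊔ T) + dim (S ⊓ T) = dim S + dim T` (`Submodule.finrank_sup_add_finrank_inf_eq`) concludes.

Sources: P. Deligne, *Les constantes des équations fonctionnelles des fonctions L*, Antwerp II,
LNM 349 (1973), §8.5–8.6 (morphisms of Weil–Deligne representations); G. Henniart, *Une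
caractérisation de la correspondance de Langlands locale pour `GL(n)`*, Bull. Soc. Math. France 130
(2002), §4.  Standard axioms only; no `sorry`.
-/

noncomputable section

set_option linter.dupNamespace false

open Module
open Literature.NumberTheory.Automorphic Literature.NumberTheory.GaloisRepresentations
open Literature.NumberTheory.GaloisRepresentations.WeilGroup
open Literature.NumberTheory.GaloisRepresentations.IsNonarchimedeanLocalField

namespace Summit.Langlands.Langlands.Theorems.ReciprocityUpToIrreducibilityR

variable {F : Type} [Field F] [ValuativeRel F] [TopologicalSpace F] [IsNonarchimedeanLocalField F]

section HomAdditivity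

variable {W : Type*} [AddCommGroup W] [Module ℂ W] {V : Type*} [AddCommGroup V] [Module ℂ V]

/-! ## Linear projections separating two disjoint subspaces -/

/-- Over a field, two subspaces `A, B` with `A ⊓ B = 0` are separated by a linear projection:
some `P : V → V` is the identity on `A` and vanishes on `B` (project onto `A` along `B ⊔ C`, `C` a
complement of `A ⊔ B`). [folklore] -/
theorem exists_proj_of_disjoint {A B : Submodule ℂ V} (hAB : Disjoint A B) :
    ∃ P : V →ₗ[ℂ] V, (∀ a ∈ A, P a = a) ∧ ∀ b ∈ B, P b = 0 := by
  obtain ⟨C, hC⟩ := Submodule.exists_isCompl (A ⊔ B)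
  have hAc : IsCompl A (B ⊔ C) := hAB.isCompl_sup_right_of_isCompl_sup_left hC
  exact ⟨A.projection (B ⊔ C) hAc, fun a ha => Submodule.projection_apply_of_mem_left hAc ha,
    fun b hb => Submodule.projection_apply_of_mem_right hAc (Submodule.mem_sup_left hb)⟩

/-- A projection `P` (identity on `A`, zero on `B`) commutes on `A ⊔ B` with every linear map
preserving `A` and `B`. [folklore] -/
theorem proj_apply_comm {A B : Submodule ℂ V} {P : V →ₗ[ℂ] V} (hPA : ∀ a ∈ A, P a = a)
    (hPB : ∀ b ∈ B, P b = 0) {g : V →ₗ[ℂ] V} (hgA : ∀ a ∈ A, g a ∈ A) (hgB : ∀ b ∈ B, g b ∈ B)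
    {v : V} (hv : v ∈ A ⊔ B) : P (g v) = g (P v) := by
  obtain ⟨a, ha, b, hb, rfl⟩ := Submodule.mem_sup.mp hv
  simp only [map_add, hPA a ha, hPB b hb, hPA _ (hgA a ha), hPB _ (hgB b hb), add_zero]

/-- A projection `P` (identity on `A`, zero on `B`) maps `A ⊔ B` into `A`. [folklore] -/
theorem proj_apply_mem {A B : Submodule ℂ V} {P : V →ₗ[ℂ] V} (hPA : ∀ a ∈ A, P a = a)
    (hPB : ∀ b ∈ B, P b = 0) {v : V} (hv : v ∈ A ⊔ B) : P v ∈ A := by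
  obtain ⟨a, ha, b, hb, rfl⟩ := Submodule.mem_sup.mp hv
  simpa only [map_add, hPA a ha, hPB b hb, add_zero] using ha

/-! ## `Hom_WD(τ, σ; ·)` over a direct sum of sub-Weil–Deligne representations -/

/-- `Hom_WD(τ, σ; U)` is monotone in `U`. [cite: Deligne1973Constantes, 8.5–8.6] -/
theorem homWDIn_mono (τ : WeilDeligneRep F ℂ W) (σ : WeilDeligneRep F ℂ V) {U U' : Submodule ℂ V}
    (h : U ≤ U') : homWDIn τ σ U ≤ homWDIn τ σ U' :=
  fun _ hf => ⟨hf.1, fun x => h (hf.2 x)⟩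

/-- **Projecting a morphism onto a stable summand.**  For sub-Weil–Deligne representations `A, B`
of `σ` and a linear projection `P` (identity on `A`, zero on `B`), `f ↦ P ∘ f` maps
`Hom_WD(τ, σ; A ⊔ B)` into `Hom_WD(τ, σ; A)`: with `f x = a + b`,
`P (ρ(w) (a + b)) = ρ(w) a = ρ(w) (P (a + b))` and likewise for `N`.
[cite: Deligne1973Constantes, 8.5–8.6] -/
theorem comp_mem_homWDIn_of_proj {τ : WeilDeligneRep F ℂ W} {σ : WeilDeligneRep F ℂ V}
    {A B : Submodule ℂ V} (hA : σ.IsSubrep A) (hB : σ.IsSubrep B) {P : V →ₗ[ℂ] V}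
    (hPA : ∀ a ∈ A, P a = a) (hPB : ∀ b ∈ B, P b = 0) {f : W →ₗ[ℂ] V}
    (hf : f ∈ homWDIn τ σ (A ⊔ B)) : P ∘ₗ f ∈ homWDIn τ σ A := by
  obtain ⟨⟨hfρ, hfN⟩, hfU⟩ := hf
  refine ⟨⟨fun w => ?_, ?_⟩, fun x => proj_apply_mem hPA hPB (hfU x)⟩
  · refine LinearMap.ext fun x => ?_
    have hx : f (τ.ρ w x) = σ.ρ w (f x) := congr($(hfρ w) x)
    simp only [LinearMap.coe_comp, Function.comp_apply, hx]
    exact proj_apply_comm hPA hPB (fun a ha => hA.1 w ha) (fun b hb => hB.1 w hb) (hfU x)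
  · refine LinearMap.ext fun x => ?_
    have hx : f (τ.N x) = σ.N (f x) := congr($hfN x)
    simp only [LinearMap.coe_comp, Function.comp_apply, hx]
    exact proj_apply_comm hPA hPB (fun a ha => hA.2 ha) (fun b hb => hB.2 hb) (hfU x)

/-- **`Hom_WD(τ, σ; A ⊕ B) = Hom_WD(τ, σ; A) + Hom_WD(τ, σ; B)`** inside `Hom_ℂ(W, V)`, for
sub-Weil–Deligne representations `A, B` of `σ` with `A ⊓ B = 0`: `f = P ∘ f + (id - P) ∘ f` with `P`
a projection separating `A` from `B`. [cite: Henniart2002, §4] -/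
theorem homWDIn_sup_eq {τ : WeilDeligneRep F ℂ W} {σ : WeilDeligneRep F ℂ V} {A B : Submodule ℂ V}
    (hA : σ.IsSubrep A) (hB : σ.IsSubrep B) (hAB : Disjoint A B) :
    homWDIn τ σ (A ⊔ B) = homWDIn τ σ A ⊔ homWDIn τ σ B := by
  refine le_antisymm (fun f hf => ?_)
    (sup_le (homWDIn_mono τ σ le_sup_left) (homWDIn_mono τ σ le_sup_right))
  obtain ⟨P, hPA, hPB⟩ := exists_proj_of_disjoint hAB
  have hQA : ∀ a ∈ A, (LinearMap.id - P : V →ₗ[ℂ] V) a = 0 := fun a ha => by simp [hPA a ha]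
  have hQB : ∀ b ∈ B, (LinearMap.id - P : V →ₗ[ℂ] V) b = b := fun b hb => by simp [hPB b hb]
  have hf' : f ∈ homWDIn τ σ (B ⊔ A) := by rwa [sup_comm]
  refine Submodule.mem_sup.mpr ⟨P ∘ₗ f, comp_mem_homWDIn_of_proj hA hB hPA hPB hf,
    (LinearMap.id - P) ∘ₗ f, comp_mem_homWDIn_of_proj hB hA hQB hQA hf', ?_⟩
  ext x
  simp

/-- Morphisms with values in `A` and in `B` vanish when `A ⊓ B = 0`:
`Hom_WD(τ, σ; A) ⊓ Hom_WD(τ, σ; B) = 0`. [cite: Henniart2002, §4] -/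
theorem disjoint_homWDIn (τ : WeilDeligneRep F ℂ W) (σ : WeilDeligneRep F ℂ V) {A B : Submodule ℂ V}
    (hAB : Disjoint A B) : Disjoint (homWDIn τ σ A) (homWDIn τ σ B) := by
  rw [Submodule.disjoint_def] at hAB ⊢
  intro f hfA hfB
  exact LinearMap.ext fun x => hAB (f x) (hfA.2 x) (hfB.2 x)

/-- **Additivity of `dim Hom_WD(τ, σ; ·)`** over an internal direct sum `A ⊕ B` of
sub-Weil–Deligne representations of `σ` (finite-dimensional `W`, `V`):
`dim Hom_WD(τ, σ; A ⊕ B) = dim Hom_WD(τ, σ; A) + dim Hom_WD(τ, σ; B)`, from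
`Hom_WD(τ, σ; A ⊕ B) = Hom_WD(τ, σ; A) ⊕ Hom_WD(τ, σ; B)` and
`dim (S ⊔ T) + dim (S ⊓ T) = dim S + dim T`. [cite: Henniart2002, §4] -/
theorem finrank_homWDIn_sup [FiniteDimensional ℂ W] [FiniteDimensional ℂ V]
    (τ : WeilDeligneRep F ℂ W) (σ : WeilDeligneRep F ℂ V) {A B : Submodule ℂ V}
    (hA : σ.IsSubrep A) (hB : σ.IsSubrep B) (hAB : Disjoint A B) :
    finrank ℂ ↥(homWDIn τ σ (A ⊔ B)) = finrank ℂ ↥(homWDIn τ σ A) + finrank ℂ ↥(homWDIn τ σ B) := by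
  rw [homWDIn_sup_eq hA hB hAB, ← Submodule.finrank_sup_add_finrank_inf_eq,
    (disjoint_homWDIn τ σ hAB).eq_bot, finrank_bot, add_zero]

end HomAdditivity

/-- **Registered sub-goal `stub_finrank_homWDIn_sup`** (toward stub S-17a-B, Henniart 2002
Thm 1.7 (a)): `dim Hom_WD(τ, σ; ·)` is additive over an internal direct sum `A ⊕ B` of
sub-Weil–Deligne representations of `σ`. [cite: Henniart2002, §4] -/
theorem stub_finrank_homWDIn_sup : ∀ (F : Type) [Field F] [ValuativeRel F] [TopologicalSpace F] [IsNonarchimedeanLocalField F] (W : Type) [AddCommGroup W] [Module ℂ W] [FiniteDimensional ℂ W] (V : Type) [AddCommGroup V] [Module ℂ V] [FiniteDimensional ℂ V] (τ : WeilDeligneRep F ℂ W) (σ : WeilDeligneRep F ℂ V) (A B : Submodule ℂ V), σ.IsSubrep A → σ.IsSubrep B → Disjoint A B → Module.finrank ℂ ↥(homWDIn τ σ (A ⊔ B)) = Module.finrank ℂ ↥(homWDIn τ σ A) + Module.finrank ℂ ↥(homWDIn τ σ B) :=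
  fun _ _ _ _ _ _ _ _ _ _ _ _ _ τ σ _ _ hA hB hAB => finrank_homWDIn_sup τ σ hA hB hAB

end Summit.Langlands.Langlands.Theorems.ReciprocityUpToIrreducibilityR

end
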